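import Summits.HodgeConjecture.CorCM.MultiFieldWeilJointPrimes
import Summits.HodgeConjecture.CorCM.MultiFieldWeilMarkmanIntrinsic
import HarnessLib

/-!
# MULTI-FIELD WEIL ENGINE — A PRIME TOWER OVER ONE SLOT WITH A TWO-SET TYPE: below a joint prime tower, a single field whose type has TWO members over `τ` and on
# whose `τ`-embeddings `Aut(ℂ/k)` is 2-TRANSITIVE (e.g. a SIMPLE CM fourfold of Weil type over an octic field — Dodson) is peeled by separation over all 2-subsets;
# HEADLINE: a Weil-type CM fourfold, any number of `(2,3)`-fivefolds over decic fields, and `E` — GIVEN ONLY Markman's two theorems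

Cell `pub-hodgecm2` (COR-CM), seat b30 gen 30 (2026-08-24); count-neutral own lane MULTI-FIELD WEIL ENGINE (stem `MultiFieldWeil*`), sequel of
`CorCM/MultiFieldWeilJointPrimes.lean` (`pure_realisedTuples_jointPrimeTower`, `exists_prio_refining`), `CorCM/MultiFieldWeilPrimeTower.lean`
(`const_of_signed_primeTower_coprime` — for a SINGLE slot below the tower the coprimality is vacuous and only SEPARATION of its orbit is needed) and
`CorCM/MultiFieldWeilMarkmanIntrinsic.lean`.  Theorems only; no definition, no named fact of its own, no `sorry`.  HONEST FRAMING: §3ʼs general headline is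
CONDITIONAL on the displayed single-slot Weil spaces; §4 is conditional ONLY on Markman's fourfold and hyperbolic-sixfold theorems (named facts) — and, in the
`IsSimple` form, on nothing else.  `HC_CM` is NOT proved and not asserted.

* §1 **`twoSetTransitive_realisedTuples`** — 2-transitivity of `Aut(ℂ/τ(k))` on the `τ`-embeddings of `K_{m₁}` (intrinsic, as in gen 29ʼs `h2T`) gives 2-transitivity of
  the realised tuples on the points of the slot; **`mem_orbitG_of_card_two`** — then every 2-subset lies in the orbit of the two-set position set, so the orbit separates
  (`sep_of_powersetCard`).
* §2 **`exists_hasDefectsG_realisedTuples_of_jointPrimeTower_over_twoSet`** — THE DEFECT LAW: `L = {m₁}` with `|P m₁| = 2 < n m₁`, 2-transitive slot; above it a tower of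
  PRIME sizes (repetitions allowed, ANY types) larger than `n m₁`, `Aut(ℂ/τ(k))` jointly transitive within each repeated size.
* §3 **`hodgeConjectureFor_biproduct_comp_of_jointPrimeTower_over_twoSet_intrinsic`** — the headline, no frames.
* §4 **`hodgeConjectureFor_biproduct_comp_of_weilFourfold_decics`** — `B₄ ⊨ (K₄; Φ)` over an OCTIC CM field with TWO members over `τ` (a CM fourfold of WEIL TYPE for
  `k`), `Aut(ℂ)` 2-transitive on the four `τ`-embeddings, and ANY NUMBER of `(2,3)`-fivefolds over DECIC fields with jointly transitive embeddings: HC of EVERY product of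
  copies of `E, B₄, B_1, …` GIVEN ONLY Markman 4 + 6; **`…_of_isSimple`**: for `B₄` SIMPLE the 2-transitivity is Dodsonʼs theorem (`OcticWeilFourfold.twoTransitive_of_isSimple`).
  One decic field is gen 29ʼs `OcticDecicWeil22` headline through the tower; several are NEW.
[cite: Dodson1984, §3.3.2 Theorem] [cite: DixonMortimer1996, §1.6 and §2.1] [cite: MoonenZarhin1995Duke, Thm. 2.4] [cite: Pohlmann1968, Thm 1]
[cite: Markman2025SurveySecant, Thm. 1.2] [cite: Markman2025SecantWeil, Thm 1.5.1] [cite: Shimura1998, §18.2 Lemma (i)] [cite: MumfordAV1970, §19]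

## References
* [Dodson1984] B. Dodson, The structure of Galois groups of CM-fields, Trans. AMS 283 (1984), §3.3.2.  [DixonMortimer1996] J. D. Dixon, B. Mortimer, *Permutation
  Groups*, GTM 163, §1.6, §2.1.  [MoonenZarhin1995Duke] B. Moonen, Yu. Zarhin, Duke Math. J. 77 (1995), Thm. 2.4.  [Pohlmann1968] H. Pohlmann, Ann. of Math. 88
  (1968), Thm 1.  [Markman2025SurveySecant] E. Markman, arXiv:2509.23403, Thm. 1.2.  [Markman2025SecantWeil] E. Markman, Cycles on abelian 2n-folds of Weil type from
  secant sheaves on abelian n-folds, Thm 1.5.1.  [Shimura1998] G. Shimura, *Abelian varieties with CM and modular functions*, §18.2 Lemma (i).  [MumfordAV1970]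
  D. Mumford, *Abelian Varieties*, §19.
-/

noncomputable section

open CategoryTheory CategoryTheory.Limits NumberField

namespace Summit.HodgeConjecture.CorCM.MultiFieldWeil

open Finset
open Literature.AlgebraicGeometry Literature.AlgebraicGeometry.Motives Literature.AlgebraicGeometry.HodgeTheory
open Literature.AlgebraicGeometry.ComplexMultiplication (IsCMTypeRealisation)
open Literature.AlgebraicTopology.SingularHomology
open Literature.NumberTheory.ComplexMultiplication
open Summit.HodgeConjecture.CorCM.Census.MultiFieldWeil

open scoped Classical

/-! ## §1 A 2-transitive slot: the orbit of a two-set position set is the set of all 2-subsets -/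

section Realised

variable {I : Type} {r : ℕ} {Kf : I → Type} [∀ i, Field (Kf i)] [∀ i, NumberField (Kf i)] {i₀ : I} {is : Fin r → I} {n : Fin r → ℕ}
  {e : ∀ m : Fin r, (Kf (is m) →+* ℂ) ≃ Fin (n m) × Bool} {τ : Kf i₀ →+* ℂ} {im : ∀ m : Fin r, Kf i₀ →+* Kf (is m)}
  (he_sign : ∀ (m : Fin r) (s : Kf (is m) →+* ℂ), (e m s).2 = true ↔ s.comp (im m) = τ)

omit [∀ i, NumberField (Kf i)] in
include he_sign in
/-- **2-transitivity of `Aut(ℂ/τ(k))` on the `τ`-embeddings of `K_{m₁}` gives 2-transitivity of the realised tuples on the slot `m₁`.** [cite: Shimura1998, §18.2 Lemma (i)]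
[cite: DixonMortimer1996, §2.1] -/
theorem twoSetTransitive_realisedTuples (m₁ : Fin r)
    (h2T : ∀ s t s' t' : Kf (is m₁) →+* ℂ, s.comp (im m₁) = τ → t.comp (im m₁) = τ → s'.comp (im m₁) = τ → t'.comp (im m₁) = τ → s ≠ t → s' ≠ t' →
      ∃ ρ : ℂ ≃+* ℂ, (ρ : ℂ →+* ℂ).comp s = s' ∧ (ρ : ℂ →+* ℂ).comp t = t')
    {x y x' y' : Fin (n m₁)} (hxy : x ≠ y) (hxy' : x' ≠ y') :
    ∃ π ∈ realisedTuples e τ, π m₁ x = x' ∧ π m₁ y = y' := by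
  have hover : ∀ c : Fin (n m₁), ((e m₁).symm (c, true)).comp (im m₁) = τ := fun c => (he_sign m₁ _).1 (by rw [Equiv.apply_symm_apply])
  have hinj : ∀ c c' : Fin (n m₁), (e m₁).symm (c, true) = (e m₁).symm (c', true) → c = c' := fun c c' h =>
    (Prod.mk.inj ((e m₁).symm.injective h)).1
  obtain ⟨ρ, hρx, hρy⟩ := h2T _ _ _ _ (hover x) (hover y) (hover x') (hover y') (fun h => hxy (hinj _ _ h)) (fun h => hxy' (hinj _ _ h))
  have hρτ : (ρ : ℂ →+* ℂ).comp τ = τ := by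
    calc (ρ : ℂ →+* ℂ).comp τ = ((ρ : ℂ →+* ℂ).comp ((e m₁).symm (x, true))).comp (im m₁) := by rw [RingHom.comp_assoc, hover]
      _ = τ := by rw [hρx, hover]
  obtain ⟨π, hπ, hπρ⟩ := exists_mem_realisedTuples_of_comp_tau_eq (e := e) he_sign ρ hρτ
  refine ⟨π, hπ, ?_, ?_⟩
  · have h := hπρ m₁ x
    rw [hρx] at h
    exact (hinj _ _ h).symm
  · have h := hπρ m₁ y
    rw [hρy] at h
    exact (hinj _ _ h).symm

/-- **Under a 2-transitive set of tuples every 2-subset lies in the orbit of a two-set position set** (so the orbit separates, `sep_of_powersetCard`).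
[cite: DixonMortimer1996, §2.1] -/
theorem mem_orbitG_of_card_two {R : Finset (PermsG n)} {P : ∀ m : Fin r, Finset (Fin (n m))} {m₁ : Fin r} {a b : Fin (n m₁)} (hab : a ≠ b) (hP : P m₁ = {a, b})
    (h2 : ∀ x y x' y' : Fin (n m₁), x ≠ y → x' ≠ y' → ∃ π ∈ R, π m₁ x = x' ∧ π m₁ y = y')
    {Q : Finset (Fin (n m₁))} (hQ : Q.card = 2) : Q ∈ orbitG R P m₁ := by
  obtain ⟨x, y, hxy, rfl⟩ := Finset.card_eq_two.1 hQ
  obtain ⟨π, hπ, hπx, hπy⟩ := h2 x y a b hxy hab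
  refine mem_orbitG.2 ⟨π, hπ, ?_⟩
  ext z
  rw [mem_preG, hP, Finset.mem_insert, Finset.mem_singleton, Finset.mem_insert, Finset.mem_singleton, ← hπx, ← hπy]
  exact ⟨fun h => h.elim (fun h => Or.inl ((π m₁).injective h)) fun h => Or.inr ((π m₁).injective h),
    fun h => h.elim (fun h => Or.inl (by rw [h])) fun h => Or.inr (by rw [h])⟩

/-! ## §2 The defect law: a joint prime tower over one 2-transitive two-set slot -/

include he_sign in
/-- **THE DEFECT LAW — A JOINT PRIME TOWER OVER ONE SLOT WITH A TWO-SET TYPE.**  `L = {m₁}`: `P m₁` a two-set, `2 < n m₁`, `Aut(ℂ/τ(k))` 2-transitive on the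
`τ`-embeddings of `K_{m₁}`; outside `L`: PRIME sizes larger than `n m₁`, proper non-empty position sets, joint transitivity within each repeated size (`hJ`).  Every
configuration balanced under the realised tuples obeys the defect law with any `c m = n m − 2|P m|` (as integers).  [cite: MoonenZarhin1995Duke, Thm. 2.4]
[cite: DixonMortimer1996, §1.6 and §2.1] -/
theorem exists_hasDefectsG_realisedTuples_of_jointPrimeTower_over_twoSet (m₁ : Fin r)
    (hpr : ∀ m, m ≠ m₁ → (n m).Prime) (hLt : ∀ m, m ≠ m₁ → n m₁ < n m) (hn₁ : 2 < n m₁)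
    (h2T : ∀ s t s' t' : Kf (is m₁) →+* ℂ, s.comp (im m₁) = τ → t.comp (im m₁) = τ → s'.comp (im m₁) = τ → t'.comp (im m₁) = τ → s ≠ t → s' ≠ t' →
      ∃ ρ : ℂ ≃+* ℂ, (ρ : ℂ →+* ℂ).comp s = s' ∧ (ρ : ℂ →+* ℂ).comp t = t')
    (hJ : ∀ m₀, m₀ ≠ m₁ → (∃ m, m ≠ m₁ ∧ m ≠ m₀ ∧ n m = n m₀) →
      ∀ s s' : (∀ m : Fin r, Kf (is m) →+* ℂ), (∀ m, m ≠ m₁ → n m = n m₀ → (s m).comp (im m) = τ ∧ (s' m).comp (im m) = τ) →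
        ∃ ρ : ℂ ≃+* ℂ, ∀ m, m ≠ m₁ → n m = n m₀ → (ρ : ℂ →+* ℂ).comp (s m) = s' m)
    {P : ∀ m : Fin r, Finset (Fin (n m))} (hP1 : (P m₁).card = 2)
    (hP0 : ∀ m, m ≠ m₁ → (P m).Nonempty) (hPn : ∀ m, m ≠ m₁ → (P m).card < n m)
    (c : Fin r → ℕ) (hc : ∀ m, ((c m : ℕ) : ℤ) = (n m : ℤ) - 2 * (P m).card)
    {α : Type} (v : α → PtG n) (T : Finset α) (hT : ModelBalancedG P (realisedTuples e τ) v T) :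
    ∃ t : Fin r → ℤ, HasDefectsG c v T t := by
  have hmul : ∀ π ∈ realisedTuples e τ, ∀ π' ∈ realisedTuples e τ, π * π' ∈ realisedTuples e τ :=
    fun π hπ π' hπ' => mul_mem_realisedTuples e τ hπ hπ'
  have hinv : ∀ π ∈ realisedTuples e τ, π⁻¹ ∈ realisedTuples e τ := fun π hπ => inv_mem_realisedTuples hπ
  have hne : (realisedTuples e τ).Nonempty := realisedTuples_nonempty (e := e) he_sign
  -- membership in `L = {m₁}`
  have hmemL : ∀ m : Fin r, m ∈ ({m₁} : Finset (Fin r)) ↔ m = m₁ := fun m => Finset.mem_singleton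
  have hnotL : ∀ m : Fin r, m ∉ ({m₁} : Finset (Fin r)) ↔ m ≠ m₁ := fun m => by rw [hmemL]
  -- the tower: pure rotations for a priority refining the sizes
  obtain ⟨prio, hinj, hmono, hle⟩ := exists_prio_refining n
  have hpure := pure_realisedTuples_jointPrimeTower (e := e) he_sign {m₁} (fun m hm => hpr m ((hnotL m).1 hm))
    (fun m hm m' hm' => by rw [(hmemL m).1 hm]; exact hLt m' ((hnotL m').1 hm'))
    (fun m₀ hm₀ hex s s' hss' => by
      obtain ⟨m, hmL, hmm₀, hmn⟩ := hex
      obtain ⟨ρ, hρ⟩ := hJ m₀ ((hnotL m₀).1 hm₀) ⟨m, (hnotL m).1 hmL, hmm₀, hmn⟩ s s' fun m hm hn => hss' m ((hnotL m).2 hm) hn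
      exact ⟨ρ, fun m hm hn => hρ m ((hnotL m).1 hm) hn⟩)
  -- the two-set slot: 2-transitivity, all 2-subsets in the orbit, separation
  obtain ⟨a, b, hab, hPab⟩ := Finset.card_eq_two.1 hP1
  have h2 : ∀ x y x' y' : Fin (n m₁), x ≠ y → x' ≠ y' → ∃ π ∈ realisedTuples e τ, π m₁ x = x' ∧ π m₁ y = y' :=
    fun x y x' y' hxy hxy' => twoSetTransitive_realisedTuples (e := e) he_sign m₁ h2T hxy hxy'
  have hconst := const_of_signed_primeTower_coprime (P := P) hmul hinv hne {m₁} prio (fun m hm => hpr m ((hnotL m).1 hm))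
    (fun m m' _ _ h => hinj h) (fun m hm => hP0 m ((hnotL m).1 hm)) (fun m hm => hPn m ((hnotL m).1 hm))
    (fun m₀ hm₀ => by
      obtain ⟨ρ, hρ, hρL, hρle, hord⟩ := hpure m₀ hm₀
      exact ⟨ρ, hρ, hρL, fun m hmL hlt => hρle m hmL (fun h => by rw [h] at hlt; exact lt_irrefl _ hlt) (hle m m₀ hlt), hord⟩)
    (fun m hm m' hm' hmm' => absurd (((hmemL m).1 hm).trans ((hmemL m').1 hm').symm) hmm')
    (fun m hm f hf => by
      obtain rfl := (hmemL m).1 hm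
      exact sep_of_powersetCard (p := 2) (by norm_num) hn₁ (fun Q hQ => mem_orbitG_of_card_two hab hPab h2 hQ) f hf)
    fun π hπ => signed_of_modelBalancedG (realisedTuples e τ) v hT hπ
  obtain ⟨t, hd, he'⟩ := exists_defects_of_const (P := P) hne hconst fun π hπ => signed_of_modelBalancedG (realisedTuples e τ) v hT hπ
  refine ⟨t, fun m a => hd m a, ?_⟩
  rw [he']
  exact Finset.sum_congr rfl fun m _ => by rw [hc m]

end Realised

/-! ## §3 The headline (intrinsic form) -/

section Headline

variable {I : Type} {r : ℕ} {Kf : I → Type} [∀ i, Field (Kf i)] [∀ i, NumberField (Kf i)] [∀ i, IsCMField (Kf i)]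
  {i₀ : I} {is : Fin r → I} {n : Fin r → ℕ} {τ : Kf i₀ →+* ℂ}
  {A : Fin (r + 1) → AbelianVariety ℂ} {Φ : ∀ j : Fin (r + 1), CMType (Kf (mfSlots i₀ is j))}
  {ι : ∀ j, 𝓞 (Kf (mfSlots i₀ is j)) →+* End (A j)}
  {θ : ∀ j, Kf (mfSlots i₀ is j) →+* Module.End ℂ (complexBetti (A j).X 1)}

/-- **HEADLINE — A JOINT PRIME TOWER OVER ONE 2-TRANSITIVE SLOT WITH A TWO-SET TYPE (intrinsic form).**  `E = A 0 ⊨ (k; {τ})`, `B_m = A (m+1) ⊨ (K_m; Φ (m+1))`,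
`[K_m : ℚ] = 2 n_m`, `p_m` members over `τ`.  Slot `m₁`: `p_{m₁} = 2`, `4 ≤ n_{m₁}`, `Aut(ℂ/τ(k))` 2-transitive on the `τ`-embeddings (`h2T`).  Slots `m ≠ m₁`: `n_m` PRIME, `n_{m₁} < n_m`, `0 < p_m`, `2p_m ≤ n_m`, joint transitivity within each repeated size (`hJ`).  Then the Hodge conjecture
holds for EVERY product of copies `⨁_j A(κ j)` GIVEN the single-slot Weil spaces `hW m`.  `HC_CM` is NOT asserted. [cite: Pohlmann1968, Thm 1]
[cite: MoonenZarhin1995Duke, Thm. 2.4] [cite: DixonMortimer1996, §1.6 and §2.1] [cite: Shimura1998, §18.2 Lemma (i)] -/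
theorem hodgeConjectureFor_biproduct_comp_of_jointPrimeTower_over_twoSet_intrinsic (p : Fin r → ℕ) (m₁ : Fin r)
    (hpr : ∀ m, m ≠ m₁ → (n m).Prime) (hLt : ∀ m, m ≠ m₁ → n m₁ < n m) (hp1 : p m₁ = 2) (hn₁ : 4 ≤ n m₁)
    (hp0 : ∀ m, 0 < p m) (hpn : ∀ m, 2 * p m ≤ n m)
    {N : ℕ} (κ : Fin N → Fin (r + 1)) (h2 : Module.finrank ℚ (Kf i₀) = 2) (hdeg : ∀ m : Fin r, Module.finrank ℚ (Kf (is m)) = 2 * n m)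
    (im : ∀ m : Fin r, Kf i₀ →+* Kf (is m))
    (h2T : ∀ s t s' t' : Kf (is m₁) →+* ℂ, s.comp (im m₁) = τ → t.comp (im m₁) = τ → s'.comp (im m₁) = τ → t'.comp (im m₁) = τ → s ≠ t → s' ≠ t' →
      ∃ ρ : ℂ ≃+* ℂ, (ρ : ℂ →+* ℂ).comp s = s' ∧ (ρ : ℂ →+* ℂ).comp t = t')
    (hJ : ∀ m₀, m₀ ≠ m₁ → (∃ m, m ≠ m₁ ∧ m ≠ m₀ ∧ n m = n m₀) →
      ∀ s s' : (∀ m : Fin r, Kf (is m) →+* ℂ), (∀ m, m ≠ m₁ → n m = n m₀ → (s m).comp (im m) = τ ∧ (s' m).comp (im m) = τ) →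
        ∃ ρ : ℂ ≃+* ℂ, ∀ m, m ≠ m₁ → n m = n m₀ → (ρ : ℂ →+* ℂ).comp (s m) = s' m)
    {δ : 𝓞 (Kf i₀)} {d : ℕ} (hτ : τ (δ : Kf i₀) = Complex.I * (Real.sqrt d : ℂ))
    (hA : ∀ j, IsCMTypeRealisation (Φ j) (A j) (ι j) (θ j))
    (hΨ : ∀ σ : Kf i₀ →+* ℂ, σ ∈ (Φ 0).1 ↔ σ = τ)
    (hp : ∀ m : Fin r, (Finset.univ.filter fun s : Kf (is m) →+* ℂ => s.comp (im m) = τ ∧ s ∈ (Φ m.succ).1).card = p m)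
    (hW : ∀ m : Fin r, weilClassesOf (⨁ fun i => A (partSlots (n m - 2 * p m) m i))
      (biproduct.map fun i => ι (partSlots (n m - 2 * p m) m i) (δfam im δ (partSlots (n m - 2 * p m) m i))) (n m - p m) d ≤
      algebraicClasses (⨁ fun i => A (partSlots (n m - 2 * p m) m i)).X (n m - p m)) :
    HodgeConjectureFor (⨁ fun j => A (κ j)).dim (⨁ fun j => A (κ j)).X := by
  have hττ : ComplexEmbedding.conjugate τ ≠ τ := QuarticCM.conjugate_ne τ
  have hk : ∀ σ : Kf i₀ →+* ℂ, σ = τ ∨ σ = ComplexEmbedding.conjugate τ := fun σ => QuarticCM.eq_or_eq_conjugate_of_quadratic h2 τ σ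
  have hfr : ∀ m : Fin r, ∃ e : (Kf (is m) →+* ℂ) ≃ Fin (n m) × Bool, (∀ s, (e s).2 = true ↔ s.comp (im m) = τ) ∧
      ∀ s, e (ComplexEmbedding.conjugate s) = ((e s).1, !(e s).2) := fun m => exists_signFrame (hdeg m) h2 (im m) hττ hk
  choose e he_sign he_conj using hfr
  let P : ∀ m : Fin r, Finset (Fin (n m)) := fun m => Finset.univ.filter fun a : Fin (n m) => (e m).symm (a, true) ∈ (Φ m.succ).1
  have hcard : ∀ m, (P m).card = p m := fun m => (card_posSet (he_sign m) (Φ m.succ)).trans (hp m)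
  exact hodgeConjectureFor_biproduct_comp_of_defectLawG (is := is) P (fun m => n m - 2 * p m) (fun m => n m - p m)
    (fun m => by have := hpn m; omega) (fun m => by have := hp0 m; have := hpn m; omega) κ h2 im hτ hA e he_sign he_conj hΨ
    (fun m s => mem_iff_snd_eq_decide_mem_posSet (he_conj m) (Φ m.succ) s)
    (fun v T hT => exists_hasDefectsG_realisedTuples_of_jointPrimeTower_over_twoSet (e := e) he_sign m₁ hpr hLt (by omega) h2T hJ
      (by rw [hcard m₁, hp1]) (fun m _ => Finset.card_pos.1 (by rw [hcard m]; exact hp0 m))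
      (fun m _ => by have := hpn m; have := hp0 m; rw [hcard m]; omega)
      (fun m => n m - 2 * p m) (cast_sub_two_mul_eq hcard hpn) v T hT) hW

end Headline

/-! ## §4 A Weil-type CM fourfold, any number of decic `(2,3)`-fields, and `E` — Markman's theorems only -/

section Markman

variable {I : Type} {r : ℕ} {Kf : I → Type} [∀ i, Field (Kf i)] [∀ i, NumberField (Kf i)] [∀ i, IsCMField (Kf i)]
  {i₀ : I} {is : Fin (r + 1) → I} {τ : Kf i₀ →+* ℂ}
  {A : Fin (r + 1 + 1) → AbelianVariety ℂ} {Φ : ∀ j : Fin (r + 1 + 1), CMType (Kf (mfSlots i₀ is j))}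
  {ι : ∀ j, 𝓞 (Kf (mfSlots i₀ is j)) →+* End (A j)}
  {θ : ∀ j, Kf (mfSlots i₀ is j) →+* Module.End ℂ (complexBetti (A j).X 1)}

/-- **HEADLINE — A CM FOURFOLD OF WEIL TYPE, ANY NUMBER OF `(2,3)`-FIVEFOLDS OVER DECIC FIELDS, AND `E`, GIVEN ONLY MARKMAN'S TWO THEOREMS.**  Slot `0`:
`B₄ = A 1 ⊨ (K_0; Φ 1)` (slot `0`, i.e. `A (Fin.succ 0)`) over an OCTIC CM field (`[K_0 : ℚ] = 8`) with TWO members over `τ` and `Aut(ℂ/τ(k))` 2-TRANSITIVE on the four `τ`-embeddings (`h2T`; automatic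
for `B₄` simple, see `…_of_isSimple`); slots `j.succ`: `(2,3)`-fivefolds over DECIC fields (`[K : ℚ] = 10`, two members over `τ`) with `Aut(ℂ/τ(k))` jointly transitive
on their tuples of `τ`-embeddings (`hJ`, vacuous for one decic field).  Then the Hodge conjecture holds for EVERY product of copies `⨁_j A(κ j)` of `E, B₄, B_1, …, B_r`.
`HC_CM` is NOT asserted. [cite: Markman2025SurveySecant, Thm. 1.2] [cite: Markman2025SecantWeil, Thm 1.5.1] [cite: Pohlmann1968, Thm 1] [cite: DixonMortimer1996, §2.1] -/
theorem hodgeConjectureFor_biproduct_comp_of_weilFourfold_decics (hW4 : Markman2025_weilClasses_algebraic_abelianFourfold)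
    (hM6 : Markman2025_weilClasses_algebraic_hyperbolicSixfold) {N : ℕ} (κ : Fin N → Fin (r + 1 + 1)) (h2 : Module.finrank ℚ (Kf i₀) = 2)
    (h8 : Module.finrank ℚ (Kf (is 0)) = 8) (h10 : ∀ j : Fin r, Module.finrank ℚ (Kf (is j.succ)) = 10)
    (im : ∀ m : Fin (r + 1), Kf i₀ →+* Kf (is m)) (hA : ∀ j, IsCMTypeRealisation (Φ j) (A j) (ι j) (θ j)) (hΨ : ∀ σ : Kf i₀ →+* ℂ, σ ∈ (Φ 0).1 ↔ σ = τ)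
    (h22 : ∀ m : Fin (r + 1), (Finset.univ.filter fun s : Kf (is m) →+* ℂ => s.comp (im m) = τ ∧ s ∈ (Φ m.succ).1).card = 2)
    (h2T : ∀ s t s' t' : Kf (is 0) →+* ℂ, s.comp (im 0) = τ → t.comp (im 0) = τ → s'.comp (im 0) = τ → t'.comp (im 0) = τ → s ≠ t → s' ≠ t' →
      ∃ ρ : ℂ ≃+* ℂ, (ρ : ℂ →+* ℂ).comp s = s' ∧ (ρ : ℂ →+* ℂ).comp t = t')
    (hJ : ∀ s s' : (∀ m : Fin (r + 1), Kf (is m) →+* ℂ), (∀ j : Fin r, (s j.succ).comp (im j.succ) = τ ∧ (s' j.succ).comp (im j.succ) = τ) →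
      ∃ ρ : ℂ ≃+* ℂ, ∀ j : Fin r, (ρ : ℂ →+* ℂ).comp (s j.succ) = s' j.succ) :
    HodgeConjectureFor (⨁ fun j => A (κ j)).dim (⨁ fun j => A (κ j)).X := by
  obtain ⟨δ₀, d, hd, hδ₀⟩ := CyclicSextic.exists_sq_eq_neg_nat_of_isTotallyComplex (Kf i₀) h2
  obtain ⟨δ, hδ, hτ⟩ := OcticCurveFourfold.exists_delta_of_mem h2 hd hδ₀ τ
  -- sizes `(4; 5, …, 5)`, two members everywhere
  let n : Fin (r + 1) → ℕ := Fin.cons 4 fun _ => 5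
  have hn0 : n 0 = 4 := rfl
  have hns : ∀ j : Fin r, n j.succ = 5 := fun j => rfl
  have hne0 : ∀ m : Fin (r + 1), m ≠ 0 → ∃ j : Fin r, m = j.succ := fun m hm => (Fin.eq_zero_or_eq_succ m).resolve_left hm
  have hdeg : ∀ m : Fin (r + 1), Module.finrank ℚ (Kf (is m)) = 2 * n m := fun m => by
    rcases Fin.eq_zero_or_eq_succ m with rfl | ⟨j, rfl⟩
    · rw [hn0, h8]
    · rw [hns, h10 j]
  have hpr' : ∀ m : Fin (r + 1), m ≠ 0 → (n m).Prime := fun m hm => by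
    obtain ⟨j, rfl⟩ := hne0 m hm
    rw [hns]; norm_num
  have hLt' : ∀ m : Fin (r + 1), m ≠ 0 → n 0 < n m := fun m hm => by
    obtain ⟨j, rfl⟩ := hne0 m hm
    rw [hn0, hns]; norm_num
  have hpn' : ∀ m : Fin (r + 1), 2 * 2 ≤ n m := fun m => by
    rcases Fin.eq_zero_or_eq_succ m with rfl | ⟨j, rfl⟩
    · exact hn0.ge
    · rw [hns]; norm_num
  have hJ' : ∀ m₀ : Fin (r + 1), m₀ ≠ 0 → (∃ m, m ≠ 0 ∧ m ≠ m₀ ∧ n m = n m₀) →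
      ∀ s s' : (∀ m : Fin (r + 1), Kf (is m) →+* ℂ), (∀ m, m ≠ 0 → n m = n m₀ → (s m).comp (im m) = τ ∧ (s' m).comp (im m) = τ) →
        ∃ ρ : ℂ ≃+* ℂ, ∀ m, m ≠ 0 → n m = n m₀ → (ρ : ℂ →+* ℂ).comp (s m) = s' m := by
    intro m₀ hm₀ _ s s' hss'
    obtain ⟨j₀, rfl⟩ := hne0 m₀ hm₀
    obtain ⟨ρ, hρ⟩ := hJ s s' fun j => hss' j.succ (Fin.succ_ne_zero j) (by rw [hns, hns])
    refine ⟨ρ, fun m hm _ => ?_⟩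
    obtain ⟨j, rfl⟩ := hne0 m hm
    exact hρ j
  have hW : ∀ m : Fin (r + 1), weilClassesOf (⨁ fun i => A (partSlots (n m - 2 * 2) m i))
      (biproduct.map fun i => ι (partSlots (n m - 2 * 2) m i) (δfam im δ (partSlots (n m - 2 * 2) m i))) (n m - 2) d ≤
      algebraicClasses (⨁ fun i => A (partSlots (n m - 2 * 2) m i)).X (n m - 2) := fun m => by
    rcases Fin.eq_zero_or_eq_succ m with rfl | ⟨j, rfl⟩
    · exact weilHyp_of_markman_fourfold22_intrinsic hW4 0 h8 h2 hd hδ hA (h22 0)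
    · exact weilHyp_of_markman_sixfold_decic_intrinsic (is := is) hM6 j.succ (h10 j) h2 hd hδ hA hΨ (h22 j.succ)
  exact hodgeConjectureFor_biproduct_comp_of_jointPrimeTower_over_twoSet_intrinsic (is := is) (n := n) (fun _ => 2) 0 hpr' hLt' rfl hn0.ge
    (fun _ => Nat.succ_pos 1) hpn' κ h2 hdeg im h2T hJ' hτ hA hΨ h22 hW

/-- **… with `B₄` SIMPLE: the 2-transitivity is Dodson's theorem** (`OcticWeilFourfold.twoTransitive_of_isSimple` BY NAME): a SIMPLE CM fourfold of Weil type over ANY octic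
CM field, any number of `(2,3)`-fivefolds over decic fields with jointly transitive embeddings, and `E` — HC of every product of copies GIVEN ONLY Markman 4 + 6.
`HC_CM` is NOT asserted. [cite: Dodson1984, §3.3.2 Theorem] [cite: Markman2025SurveySecant, Thm. 1.2] [cite: Markman2025SecantWeil, Thm 1.5.1] -/
theorem hodgeConjectureFor_biproduct_comp_of_weilFourfold_decics_of_isSimple (hW4 : Markman2025_weilClasses_algebraic_abelianFourfold)
    (hM6 : Markman2025_weilClasses_algebraic_hyperbolicSixfold) {N : ℕ} (κ : Fin N → Fin (r + 1 + 1)) (h2 : Module.finrank ℚ (Kf i₀) = 2)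
    (h8 : Module.finrank ℚ (Kf (is 0)) = 8) (h10 : ∀ j : Fin r, Module.finrank ℚ (Kf (is j.succ)) = 10)
    (im : ∀ m : Fin (r + 1), Kf i₀ →+* Kf (is m)) (hA : ∀ j, IsCMTypeRealisation (Φ j) (A j) (ι j) (θ j)) (hS : (A (Fin.succ 0)).IsSimple)
    (hΨ : ∀ σ : Kf i₀ →+* ℂ, σ ∈ (Φ 0).1 ↔ σ = τ)
    (h22 : ∀ m : Fin (r + 1), (Finset.univ.filter fun s : Kf (is m) →+* ℂ => s.comp (im m) = τ ∧ s ∈ (Φ m.succ).1).card = 2)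
    (hJ : ∀ s s' : (∀ m : Fin (r + 1), Kf (is m) →+* ℂ), (∀ j : Fin r, (s j.succ).comp (im j.succ) = τ ∧ (s' j.succ).comp (im j.succ) = τ) →
      ∃ ρ : ℂ ≃+* ℂ, ∀ j : Fin r, (ρ : ℂ →+* ℂ).comp (s j.succ) = s' j.succ) :
    HodgeConjectureFor (⨁ fun j => A (κ j)).dim (⨁ fun j => A (κ j)).X :=
  hodgeConjectureFor_biproduct_comp_of_weilFourfold_decics hW4 hM6 κ h2 h8 h10 im hA hΨ h22
    (OcticWeilFourfold.twoTransitive_of_isSimple h8 h2 (im 0) (hA (Fin.succ 0)) hS τ (h22 0)) hJ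

end Markman

end Summit.HodgeConjecture.CorCM.MultiFieldWeil

end
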